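import Summits.QuantumFields.YangMills.Theorems.BalabanUVNodesN15TwoSpacingGluingLocalityFar
import HarnessLib

/-!
# N15 = NE2, road (c) — PROGRAMME (PC), towards (PC-B): THE COARSE KIT — walk locality of `Q′G′²Q′ᵀ` from walk locality of `G′` and block-diagonal closeness of `Q′`: an abstract
# block-majorant estimate `QGGR − Q₁G₁G₁R₁ ≤ (C₁ + C₂e^{−md_Z(y)})e^{−ρd}` when `G − G₁`, `Q − Q₁`, `R − R₁` are `(s + fe^{−cd_Z})`-small (dag-n15-c g27, n15-c∕297)

Cell `pub-ymgap`, seat `pub-ymgap-dag-n15-c` (generation g27; R134 (a), s1; HUMAN RULING D-0062).  `bears_on: R4∕N15 · K3⁸ SpineGivenEndpointR13SepCoPHV (stmt-QuantumFields-27366)`;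
filed `--kind proof --supports stmt-QuantumFields-27366 --as helper` — COUNT-NEUTRAL.  Pure block-majorant algebra (b11 `HasMaj`); 0 `def`, 0 `sorry`.  Imports n15-c∕290
`…TwoSpacingGluingLocalityFar` (b11 `hasMaj_comp`, `conv_exp_le`; the far-weight kernels' shapes).  Nothing in the tree is modified.

WHY ((PC-B), [B9] (3.95)–(3.96) p.411).  The flat local models `S(𝟙) = Q′G′(𝟙)²Q′ᵀ` of the per-cube expansion of `(Q′G′²Q′ᵀ)⁻¹(U)` leave the defect `(S(U) − S(𝟙))` near the cube;
n15-c∕296 bounds `G′(U) − G′(𝟙)` by `(s + fe^{−cd_Z(y)})e^{−δd}` (near data small, far data behind the walk tail); this file lifts such a bound through the two `G′` factors and the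
block averagings: `QGGR − Q₁G₁G₁R₁ = (Q−Q₁)GGR + Q₁(G−G₁)GR + Q₁G₁(G−G₁)R + Q₁G₁G₁(R−R₁)`, every product estimated by b11's exponential convolution with the near∕far weight carried to
the OUTPUT variable (the Lipschitz minorant `d_Z(y) ≤ d(y,z) + d_Z(z)` moves a weight from an intermediate point to the output at the cost of the rate `m`).

WHAT.  §1 `hasMaj_nfW_comp_exp` (weight on the left factor's output), `hasMaj_comp_nfW` (weight at the intermediate point ⟹ at the output, rate `m`), `sop_sub_sop_eq` (the four-term
identity); §2 ★★★ `hasMaj_sop_sub_sop`: `Q, Q₁ : F → C`, `R, R₁ : C → F`, `G, G₁ : F → F` with rows `τe^{−δd}` (`Q₁, R`), `Be^{−δd}` (`G, G₁`), and differences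
`Q − Q₁ ≤ (s_Q + f_Qe^{−cd_Z(y)})·pe^{−δd}`, `R − R₁ ≤ (s_Q + f_Qe^{−cd_Z(y)})·pe^{−δd}`, `G − G₁ ≤ (s_G + f_Ge^{−cd_Z(y)})·be^{−δd}`; rates `r₃ ≤ r₂ ≤ r₁ ≤ δ`, `r₁ + σ + m ≤ δ`,
`r₂ + σ + m ≤ r₁`, `r₃ + σ + m ≤ r₂`, `0 ≤ m ≤ c` ⟹ `QGGR − Q₁G₁G₁R₁ ≤ (C₁ + C₂e^{−md_Z(y)})e^{−r₃d}` with `C₁` linear in `s_Q, s_G` and `C₂` linear in `f_Q, f_G` (explicit).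

HONEST FRAMING ∕ LIMITS.  Algebra of majorants; no operator of record estimated; [B9] cited for MECHANISM.  NE2⁺ NOT PRINTED, NOT proved; N15 of record untouched; K3⁸ OPEN; counts
UNMOVED.  Restate-immune (no Theses import).
-/

set_option autoImplicit false

noncomputable section
open scoped BigOperators
open Finset

namespace Summit.QuantumFields.YangMills.BalabanUVNodes.N15.Gluing

open Literature.MathematicalPhysics.QuantumFieldTheory.Balaban1983to89
open Literature.MathematicalPhysics.QuantumFieldTheory.Balaban1983to89.B11SectG (BlockNorm HasMaj RowSum hasMaj_comp conv_exp_le)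
open Literature.MathematicalPhysics.QuantumFieldTheory.Balaban1983to89.B6RandomWalk (Triangle254)

/-! ## §1 Kernels with a near∕far weight `s + f·e^{−c·d_Z}` and the four-term identity -/

section Kernels

variable {g : B6.Geometry} {F₁ F₂ F₃ : Type} [AddCommGroup F₁] [Module ℝ F₁] [AddCommGroup F₂] [Module ℝ F₂] [AddCommGroup F₃] [Module ℝ F₃]
  (dZ : g.Site → ℝ) {σ cr : ℝ}

/-- A nonnegative OUTPUT weight of a left factor passes a composition: `T₁ ≤ u(y)·a₁e^{−ρ₁d}`, `T₂ ≤ a₂e^{−ρ₂d}` ⟹ `T₁∘T₂ ≤ u(y)·κ₂a₁a₂c_r·e^{−ρd}` (`0 ≤ ρ ≤ ρ₂`, `ρ + σ ≤ ρ₁`).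
[folklore] -/
theorem hasMaj_nfW_comp_exp {b₁ : BlockNorm g F₁} {b₂ : BlockNorm g F₂} {b₃ : BlockNorm g F₃} {T₁ : F₂ →ₗ[ℝ] F₃} {T₂ : F₁ →ₗ[ℝ] F₂} {u : g.Site → ℝ} {a₁ a₂ ρ₁ ρ₂ ρ : ℝ}
    (htri : Triangle254 g) (hd : ∀ a b : g.Site, 0 ≤ g.dist a b) (hrow : RowSum g σ cr) (hu : ∀ y, 0 ≤ u y) (ha₁ : 0 ≤ a₁) (ha₂ : 0 ≤ a₂) (hρ : 0 ≤ ρ) (hρρ₂ : ρ ≤ ρ₂)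
    (hρρ₁ : ρ + σ ≤ ρ₁) (h₁ : HasMaj b₂ b₃ T₁ (fun y z => u y * (a₁ * Real.exp (-(ρ₁ * g.dist y z)))))
    (h₂ : HasMaj b₁ b₂ T₂ (fun z y' => a₂ * Real.exp (-(ρ₂ * g.dist z y')))) :
    HasMaj b₁ b₃ (T₁ ∘ₗ T₂) (fun y y' => u y * (b₂.κ * a₁ * a₂ * cr * Real.exp (-(ρ * g.dist y y')))) := by
  refine (hasMaj_comp h₁ h₂ fun a b => mul_nonneg (hu a) (mul_nonneg ha₁ (Real.exp_nonneg _))).mono fun y y' => ?_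
  have hconv := conv_exp_le (ρ₁ := ρ₁) (ρ₂ := ρ₂) (ρ := ρ) htri hd hrow hρ hρρ₂ hρρ₁ y y'
  have hc0 : 0 ≤ u y * (b₂.κ * a₁ * a₂) := by have := b₂.κ_nonneg; have := hu y; positivity
  calc ∑ z : g.Site, u y * (a₁ * Real.exp (-(ρ₁ * g.dist y z))) * (b₂.κ * (a₂ * Real.exp (-(ρ₂ * g.dist z y'))))
      = u y * (b₂.κ * a₁ * a₂) * ∑ z : g.Site, Real.exp (-(ρ₁ * g.dist y z)) * Real.exp (-(ρ₂ * g.dist z y')) := by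
        rw [Finset.mul_sum]; exact Finset.sum_congr rfl fun z _ => by ring
    _ ≤ u y * (b₂.κ * a₁ * a₂) * (cr * Real.exp (-(ρ * g.dist y y'))) := mul_le_mul_of_nonneg_left hconv hc0
    _ = _ := by ring

/-- A near∕far weight `s + fe^{−cd_Z}` at the INTERMEDIATE point passes to the output: `T₁ ≤ a₁e^{−ρ₁d}`, `T₂ ≤ (s + fe^{−cd_Z(z)})·a₂e^{−ρ₂d}` (weight at `T₂`'s output `z`),
`0 ≤ m ≤ c`, `d_Z(y) ≤ d(y,z) + d_Z(z)`, `d_Z ≥ 0` ⟹ `T₁∘T₂ ≤ (s + fe^{−md_Z(y)})·κ₂a₁a₂c_r·e^{−ρd}` for `0 ≤ ρ ≤ ρ₂`, `ρ + σ + m ≤ ρ₁`. [folklore] -/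
theorem hasMaj_comp_nfW {b₁ : BlockNorm g F₁} {b₂ : BlockNorm g F₂} {b₃ : BlockNorm g F₃} {T₁ : F₂ →ₗ[ℝ] F₃} {T₂ : F₁ →ₗ[ℝ] F₂} {a₁ a₂ ρ₁ ρ₂ ρ c m s f : ℝ}
    (htri : Triangle254 g) (hd : ∀ a b : g.Site, 0 ≤ g.dist a b) (hrow : RowSum g σ cr) (hdZl : ∀ y z, dZ y ≤ g.dist y z + dZ z) (hdZ0 : ∀ y, 0 ≤ dZ y)
    (ha₁ : 0 ≤ a₁) (ha₂ : 0 ≤ a₂) (hs : 0 ≤ s) (hf : 0 ≤ f) (hm : 0 ≤ m) (hmc : m ≤ c) (hρ : 0 ≤ ρ) (hρρ₂ : ρ ≤ ρ₂) (hρρ₁ : ρ + σ + m ≤ ρ₁)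
    (h₁ : HasMaj b₂ b₃ T₁ (fun y z => a₁ * Real.exp (-(ρ₁ * g.dist y z))))
    (h₂ : HasMaj b₁ b₂ T₂ (fun z y' => (s + f * Real.exp (-(c * dZ z))) * (a₂ * Real.exp (-(ρ₂ * g.dist z y'))))) :
    HasMaj b₁ b₃ (T₁ ∘ₗ T₂) (fun y y' => (s + f * Real.exp (-(m * dZ y))) * (b₂.κ * a₁ * a₂ * cr * Real.exp (-(ρ * g.dist y y')))) := by
  refine (hasMaj_comp h₁ h₂ fun a b => mul_nonneg ha₁ (Real.exp_nonneg _)).mono fun y y' => ?_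
  have hκ := b₂.κ_nonneg
  have hterm : ∀ z : g.Site, a₁ * Real.exp (-(ρ₁ * g.dist y z)) * (b₂.κ * ((s + f * Real.exp (-(c * dZ z))) * (a₂ * Real.exp (-(ρ₂ * g.dist z y'))))) ≤
      (s + f * Real.exp (-(m * dZ y))) * (b₂.κ * a₁ * a₂) * (Real.exp (-((ρ₁ - m) * g.dist y z)) * Real.exp (-(ρ₂ * g.dist z y'))) := by
    intro z
    -- the far part: `e^{−ρ₁d(y,z)}e^{−cd_Z(z)} ≤ e^{−md_Z(y)}e^{−(ρ₁−m)d(y,z)}`; the near part: `e^{−ρ₁d} ≤ e^{−(ρ₁−m)d}`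
    have hfar : Real.exp (-(ρ₁ * g.dist y z)) * Real.exp (-(c * dZ z)) ≤ Real.exp (-(m * dZ y)) * Real.exp (-((ρ₁ - m) * g.dist y z)) := by
      rw [← Real.exp_add, ← Real.exp_add]
      refine Real.exp_le_exp.mpr ?_
      have h1 := mul_le_mul_of_nonneg_left (hdZl y z) hm
      have h2 : m * dZ z ≤ c * dZ z := mul_le_mul_of_nonneg_right hmc (hdZ0 z)
      nlinarith [hd y z, hdZ0 z]
    have hnear : Real.exp (-(ρ₁ * g.dist y z)) ≤ Real.exp (-((ρ₁ - m) * g.dist y z)) := Real.exp_le_exp.mpr (by nlinarith [hd y z])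
    have hsum : (s + f * Real.exp (-(c * dZ z))) * Real.exp (-(ρ₁ * g.dist y z)) ≤ (s + f * Real.exp (-(m * dZ y))) * Real.exp (-((ρ₁ - m) * g.dist y z)) := by
      have e1 : (s + f * Real.exp (-(c * dZ z))) * Real.exp (-(ρ₁ * g.dist y z)) = s * Real.exp (-(ρ₁ * g.dist y z)) + f * (Real.exp (-(ρ₁ * g.dist y z)) * Real.exp (-(c * dZ z))) := by ring
      have e2 : (s + f * Real.exp (-(m * dZ y))) * Real.exp (-((ρ₁ - m) * g.dist y z)) =
          s * Real.exp (-((ρ₁ - m) * g.dist y z)) + f * (Real.exp (-(m * dZ y)) * Real.exp (-((ρ₁ - m) * g.dist y z))) := by ring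
      rw [e1, e2]
      exact add_le_add (mul_le_mul_of_nonneg_left hnear hs) (mul_le_mul_of_nonneg_left hfar hf)
    calc a₁ * Real.exp (-(ρ₁ * g.dist y z)) * (b₂.κ * ((s + f * Real.exp (-(c * dZ z))) * (a₂ * Real.exp (-(ρ₂ * g.dist z y')))))
        = (b₂.κ * a₁ * a₂ * Real.exp (-(ρ₂ * g.dist z y'))) * ((s + f * Real.exp (-(c * dZ z))) * Real.exp (-(ρ₁ * g.dist y z))) := by ring
      _ ≤ (b₂.κ * a₁ * a₂ * Real.exp (-(ρ₂ * g.dist z y'))) * ((s + f * Real.exp (-(m * dZ y))) * Real.exp (-((ρ₁ - m) * g.dist y z))) :=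
          mul_le_mul_of_nonneg_left hsum (by positivity)
      _ = _ := by ring
  have hconv := conv_exp_le (ρ₁ := ρ₁ - m) (ρ₂ := ρ₂) (ρ := ρ) htri hd hrow hρ hρρ₂ (by linarith) y y'
  have hc0 : 0 ≤ (s + f * Real.exp (-(m * dZ y))) * (b₂.κ * a₁ * a₂) := by positivity
  calc ∑ z : g.Site, a₁ * Real.exp (-(ρ₁ * g.dist y z)) * (b₂.κ * ((s + f * Real.exp (-(c * dZ z))) * (a₂ * Real.exp (-(ρ₂ * g.dist z y')))))
      ≤ ∑ z : g.Site, (s + f * Real.exp (-(m * dZ y))) * (b₂.κ * a₁ * a₂) * (Real.exp (-((ρ₁ - m) * g.dist y z)) * Real.exp (-(ρ₂ * g.dist z y'))) :=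
        Finset.sum_le_sum fun z _ => hterm z
    _ = (s + f * Real.exp (-(m * dZ y))) * (b₂.κ * a₁ * a₂) * ∑ z : g.Site, Real.exp (-((ρ₁ - m) * g.dist y z)) * Real.exp (-(ρ₂ * g.dist z y')) := by rw [Finset.mul_sum]
    _ ≤ (s + f * Real.exp (-(m * dZ y))) * (b₂.κ * a₁ * a₂) * (cr * Real.exp (-(ρ * g.dist y y'))) := mul_le_mul_of_nonneg_left hconv hc0
    _ = _ := by ring

omit [AddCommGroup F₃] [Module ℝ F₃] in
/-- THE FOUR-TERM IDENTITY `QGGR − Q₁G₁G₁R₁ = (Q−Q₁)GGR + Q₁(G−G₁)GR + Q₁G₁(G−G₁)R + Q₁G₁G₁(R−R₁)` (right-associated). [folklore] -/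
theorem sop_sub_sop_eq (Q Q₁ : F₁ →ₗ[ℝ] F₂) (R R₁ : F₂ →ₗ[ℝ] F₁) (G G₁ : F₁ →ₗ[ℝ] F₁) :
    Q ∘ₗ (G ∘ₗ (G ∘ₗ R)) - Q₁ ∘ₗ (G₁ ∘ₗ (G₁ ∘ₗ R₁)) =
      (Q - Q₁) ∘ₗ (G ∘ₗ (G ∘ₗ R)) + Q₁ ∘ₗ ((G - G₁) ∘ₗ (G ∘ₗ R)) + Q₁ ∘ₗ (G₁ ∘ₗ ((G - G₁) ∘ₗ R)) + Q₁ ∘ₗ (G₁ ∘ₗ (G₁ ∘ₗ (R - R₁))) := by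
  simp only [LinearMap.sub_comp, LinearMap.comp_sub]
  abel

end Kernels

/-! ## §2 Walk locality of `QGGR` from walk locality of its factors -/

section Sop

variable {g : B6.Geometry} {F C : Type} [AddCommGroup F] [Module ℝ F] [AddCommGroup C] [Module ℝ C] (dZ : g.Site → ℝ) {σ cr : ℝ}

/-- ★★★ **WALK LOCALITY OF `Q′G′²Q′ᵀ` FROM ITS FACTORS' (abstract coarse kit)**: `Q, Q₁ : F → C`, `R, R₁ : C → F` (rows `τe^{−δd}` of `Q₁` and `R` only), `G, G₁ : F → F` with rows `Be^{−δd}`, and the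
differences `Q − Q₁, R − R₁ ≤ (s_Q + f_Qe^{−cd_Z(y)})·pe^{−δd}`, `G − G₁ ≤ (s_G + f_Ge^{−cd_Z(y)})·be^{−δd}` (near data `s`, far data behind `e^{−cd_Z}`); row sum `(σ, c_r)`, `d_Z` a
nonnegative Lipschitz minorant; rates `0 ≤ r₃ ≤ r₂ ≤ r₁ ≤ δ` with `r₁ + σ + m ≤ δ`, `r₂ + σ + m ≤ r₁`, `r₃ + σ + m ≤ r₂`, `0 ≤ m ≤ c` ⟹
`QGGR − Q₁G₁G₁R₁ ≤ ((s_Q·p·X + 2·s_G·b·Y + s_Q·p·Y') + (f_Q·p·X + 2·f_G·b·Y + f_Q·p·Y')·e^{−md_Z(y)})·e^{−r₃d}` with `X = κ_FB·κ_FB·κ_Fτc_r·c_r·c_r`-type products written out.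
[cite: Balaban1985BackgroundPropagators, (3.95)–(3.96) p.411, Cor. 3.8 p.410 (mechanism)] -/
theorem hasMaj_sop_sub_sop {bF : BlockNorm g F} {bC : BlockNorm g C} {Q Q₁ : F →ₗ[ℝ] C} {R R₁ : C →ₗ[ℝ] F} {G G₁ : F →ₗ[ℝ] F}
    (htri : Triangle254 g) (hd : ∀ a b : g.Site, 0 ≤ g.dist a b) (hrow : RowSum g σ cr) (hσ : 0 ≤ σ) (hcr : 0 ≤ cr) (hdZl : ∀ y z, dZ y ≤ g.dist y z + dZ z) (hdZ0 : ∀ y, 0 ≤ dZ y)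
    {τ B p b sQ fQ sG fG δ c m r₁ r₂ r₃ : ℝ} (hτ : 0 ≤ τ) (hB : 0 ≤ B) (hp : 0 ≤ p) (hb : 0 ≤ b) (hsQ : 0 ≤ sQ) (hfQ : 0 ≤ fQ) (hsG : 0 ≤ sG) (hfG : 0 ≤ fG)
    (hm : 0 ≤ m) (hmc : m ≤ c) (hr₃ : 0 ≤ r₃) (hr₃₂ : r₃ + σ + m ≤ r₂) (hr₂₁ : r₂ + σ + m ≤ r₁) (hr₁δ : r₁ + σ + m ≤ δ)
    (hQ₁ : HasMaj bF bC Q₁ (fun y y' => τ * Real.exp (-(δ * g.dist y y')))) (hR : HasMaj bC bF R (fun y y' => τ * Real.exp (-(δ * g.dist y y'))))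
    (hG : HasMaj bF bF G (fun y y' => B * Real.exp (-(δ * g.dist y y')))) (hG₁ : HasMaj bF bF G₁ (fun y y' => B * Real.exp (-(δ * g.dist y y'))))
    (hQQ : HasMaj bF bC (Q - Q₁) (fun y y' => (sQ + fQ * Real.exp (-(c * dZ y))) * (p * Real.exp (-(δ * g.dist y y')))))
    (hRR : HasMaj bC bF (R - R₁) (fun y y' => (sQ + fQ * Real.exp (-(c * dZ y))) * (p * Real.exp (-(δ * g.dist y y')))))
    (hGG : HasMaj bF bF (G - G₁) (fun y y' => (sG + fG * Real.exp (-(c * dZ y))) * (b * Real.exp (-(δ * g.dist y y'))))) :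
    HasMaj bC bC (Q ∘ₗ (G ∘ₗ (G ∘ₗ R)) - Q₁ ∘ₗ (G₁ ∘ₗ (G₁ ∘ₗ R₁)))
      (fun y y' => ((sQ + fQ * Real.exp (-(m * dZ y))) * (bF.κ * p * (bF.κ * B * (bF.κ * B * τ * cr) * cr) * cr) +
          (sG + fG * Real.exp (-(m * dZ y))) * (bF.κ * τ * (bF.κ * b * (bF.κ * B * τ * cr) * cr) * cr) +
          (sG + fG * Real.exp (-(m * dZ y))) * (bF.κ * τ * (bF.κ * B * (bF.κ * b * τ * cr) * cr) * cr) +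
          (sQ + fQ * Real.exp (-(m * dZ y))) * (bF.κ * τ * (bF.κ * B * (bF.κ * B * p * cr) * cr) * cr)) * Real.exp (-(r₃ * g.dist y y'))) := by
  have hκF := bF.κ_nonneg
  have hr₂ : 0 ≤ r₂ := by linarith
  have hr₁ : 0 ≤ r₁ := by linarith
  have hc0 : 0 ≤ c := hm.trans hmc
  have hwQ : ∀ y, 0 ≤ sQ + fQ * Real.exp (-(c * dZ y)) := fun y => by positivity
  have hwG : ∀ y, 0 ≤ sG + fG * Real.exp (-(c * dZ y)) := fun y => by positivity
  have hwGm : ∀ y, 0 ≤ sG + fG * Real.exp (-(m * dZ y)) := fun y => by positivity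
  -- the common inner products `GR ≤ κBτc_r·e^{−r₁d}` and `G(GR) ≤ κB(κBτc_r)c_r·e^{−r₂d}` (and the flat ones)
  have hGR : HasMaj bC bF (G ∘ₗ R) (fun y y' => bF.κ * B * τ * cr * Real.exp (-(r₁ * g.dist y y'))) :=
    B11SectG.hasMaj_comp_exp htri hd hrow hB hτ hr₁ (by linarith) (by linarith) hG hR
  have hGGR : HasMaj bC bF (G ∘ₗ (G ∘ₗ R)) (fun y y' => bF.κ * B * (bF.κ * B * τ * cr) * cr * Real.exp (-(r₂ * g.dist y y'))) :=
    B11SectG.hasMaj_comp_exp htri hd hrow hB (by positivity) hr₂ (by linarith) (by linarith) hG hGR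
  -- TERM 1: `(Q − Q₁)∘(GGR)` — weight on the left factor's output
  have h1 : HasMaj bC bC ((Q - Q₁) ∘ₗ (G ∘ₗ (G ∘ₗ R)))
      (fun y y' => (sQ + fQ * Real.exp (-(c * dZ y))) * (bF.κ * p * (bF.κ * B * (bF.κ * B * τ * cr) * cr) * cr * Real.exp (-(r₃ * g.dist y y')))) :=
    hasMaj_nfW_comp_exp htri hd hrow hwQ hp (by positivity) hr₃ (by linarith) (by linarith) hQQ hGGR
  -- TERM 2: `Q₁∘((G − G₁)∘(GR))` — weight at the intermediate point
  have h2a : HasMaj bC bF ((G - G₁) ∘ₗ (G ∘ₗ R)) (fun y y' => (sG + fG * Real.exp (-(c * dZ y))) * (bF.κ * b * (bF.κ * B * τ * cr) * cr * Real.exp (-(r₂ * g.dist y y')))) :=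
    hasMaj_nfW_comp_exp htri hd hrow hwG hb (by positivity) hr₂ (by linarith) (by linarith) hGG hGR
  have h2 : HasMaj bC bC (Q₁ ∘ₗ ((G - G₁) ∘ₗ (G ∘ₗ R)))
      (fun y y' => (sG + fG * Real.exp (-(m * dZ y))) * (bF.κ * τ * (bF.κ * b * (bF.κ * B * τ * cr) * cr) * cr * Real.exp (-(r₃ * g.dist y y')))) :=
    hasMaj_comp_nfW dZ htri hd hrow hdZl hdZ0 hτ (by positivity) hsG hfG hm hmc hr₃ (by linarith) (by linarith) hQ₁ h2a
  -- TERM 3: `Q₁∘(G₁∘((G − G₁)∘R))` — weight at the intermediate point, twice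
  have h3a : HasMaj bC bF ((G - G₁) ∘ₗ R) (fun y y' => (sG + fG * Real.exp (-(c * dZ y))) * (bF.κ * b * τ * cr * Real.exp (-(r₁ * g.dist y y')))) :=
    hasMaj_nfW_comp_exp htri hd hrow hwG hb hτ hr₁ (by linarith) (by linarith) hGG hR
  have h3b : HasMaj bC bF (G₁ ∘ₗ ((G - G₁) ∘ₗ R)) (fun y y' => (sG + fG * Real.exp (-(m * dZ y))) * (bF.κ * B * (bF.κ * b * τ * cr) * cr * Real.exp (-(r₂ * g.dist y y')))) :=
    hasMaj_comp_nfW dZ htri hd hrow hdZl hdZ0 hB (by positivity) hsG hfG hm hmc hr₂ (by linarith) (by linarith) hG₁ h3a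
  have h3 : HasMaj bC bC (Q₁ ∘ₗ (G₁ ∘ₗ ((G - G₁) ∘ₗ R)))
      (fun y y' => (sG + fG * Real.exp (-(m * dZ y))) * (bF.κ * τ * (bF.κ * B * (bF.κ * b * τ * cr) * cr) * cr * Real.exp (-(r₃ * g.dist y y')))) :=
    hasMaj_comp_nfW dZ htri hd hrow hdZl hdZ0 hτ (by positivity) hsG hfG hm le_rfl hr₃ (by linarith) (by linarith) hQ₁ h3b
  -- TERM 4: `Q₁∘(G₁∘(G₁∘(R − R₁)))` — weight at the intermediate point, three times
  have h4a : HasMaj bC bF (G₁ ∘ₗ (R - R₁)) (fun y y' => (sQ + fQ * Real.exp (-(m * dZ y))) * (bF.κ * B * p * cr * Real.exp (-(r₁ * g.dist y y')))) :=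
    hasMaj_comp_nfW dZ htri hd hrow hdZl hdZ0 hB hp hsQ hfQ hm hmc hr₁ (by linarith) (by linarith) hG₁ hRR
  have h4b : HasMaj bC bF (G₁ ∘ₗ (G₁ ∘ₗ (R - R₁))) (fun y y' => (sQ + fQ * Real.exp (-(m * dZ y))) * (bF.κ * B * (bF.κ * B * p * cr) * cr * Real.exp (-(r₂ * g.dist y y')))) :=
    hasMaj_comp_nfW dZ htri hd hrow hdZl hdZ0 hB (by positivity) hsQ hfQ hm le_rfl hr₂ (by linarith) (by linarith) hG₁ h4a
  have h4 : HasMaj bC bC (Q₁ ∘ₗ (G₁ ∘ₗ (G₁ ∘ₗ (R - R₁))))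
      (fun y y' => (sQ + fQ * Real.exp (-(m * dZ y))) * (bF.κ * τ * (bF.κ * B * (bF.κ * B * p * cr) * cr) * cr * Real.exp (-(r₃ * g.dist y y')))) :=
    hasMaj_comp_nfW dZ htri hd hrow hdZl hdZ0 hτ (by positivity) hsQ hfQ hm le_rfl hr₃ (by linarith) (by linarith) hQ₁ h4b
  -- assemble: the near∕far weight of TERM 1 at exponent `c` is at most the one at exponent `m`
  rw [sop_sub_sop_eq]
  refine (((h1.add h2).add h3).add h4).mono fun y y' => ?_
  have hexp : Real.exp (-(c * dZ y)) ≤ Real.exp (-(m * dZ y)) := Real.exp_le_exp.mpr (by nlinarith [hdZ0 y])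
  have hw1 : sQ + fQ * Real.exp (-(c * dZ y)) ≤ sQ + fQ * Real.exp (-(m * dZ y)) := by nlinarith
  have hA1 : 0 ≤ bF.κ * p * (bF.κ * B * (bF.κ * B * τ * cr) * cr) * cr * Real.exp (-(r₃ * g.dist y y')) := by positivity
  have := mul_le_mul_of_nonneg_right hw1 hA1
  nlinarith [this, hwGm y, Real.exp_nonneg (-(r₃ * g.dist y y')), Real.exp_nonneg (-(m * dZ y))]

end Sop

end Summit.QuantumFields.YangMills.BalabanUVNodes.N15.Gluing

end
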